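import Summits.Ventures.PackingBounds.ThreePointCert.C16QAgg1
import Summits.Ventures.PackingBounds.ThreePointCert.CheckFastFZ

/-!
# A(16, arccos 1/4) ≤ 288: kernel validation of the blocks of (i') and of the `FI` expansion (part 1)

Framing: lottery ticket; floor = certified bounds/negative ranges. Venture `PackingBounds` (cell
`pub-packcert`), three-point SDP family. Integer data of a feasible point of the Bachoc–Vallentin
semidefinite program (n = 16, s = 1/4, degree d = 8, Bachoc–Vallentin
multiplier set = cell mode sym2), derived by `cert2lean_s2.py` (sdp gen 5 fork of cert2lean_lp.py) from the exact rational certificate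
`sdp-d16-deg8-s14-sym2-lp-v1.json` of the cell (exact verifier #1 + verifier #2 of the other seat), in the units of the kernel
checker `ThreePointCert.Check` + `CheckSym2` (soundness `card_le_of_cert3S2`); Gram factors offset-encoded for the
Kronecker-packed chunk validation `ThreePointCert.CheckKron` (emitter `emitleanS2.py` = lp gen 3 emitleanK.py). Generated file: plain
lists of integers / monomials.
-/

namespace Summit.Ventures.PackingBounds.ThreePointCert.C16Q

open Literature.Geometry.DiscreteGeometry Literature.Geometry.DiscreteGeometry.PolyCert PolyCert.SPoly

set_option maxRecDepth 100000 in
set_option maxHeartbeats 0 in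
/-- Block `Q0`: rows from 0 (C16Q.gQ0K.z.length rows) of `zᵀ(LLᵀ)z` added to `[]` give `eQ0` (kernel, Kronecker-packed chunk check). -/
theorem okQ0_1 : chunkOKK C16Q.gQ0K 0 C16Q.gQ0K.z.length [] C16Q.eQ0 = true := by
  decide +kernel

set_option maxRecDepth 100000 in
set_option maxHeartbeats 0 in
/-- Block `Q1`: rows from 0 (C16Q.gQ1K.z.length rows) of `zᵀ(LLᵀ)z` added to `[]` give `eQ1` (kernel, Kronecker-packed chunk check). -/
theorem okQ1_1 : chunkOKK C16Q.gQ1K 0 C16Q.gQ1K.z.length [] C16Q.eQ1 = true := by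
  decide +kernel

set_option maxRecDepth 100000 in
set_option maxHeartbeats 0 in
/-- `FI` expansion, blocks [0, 1] (kernel, Gram form + sorted-merge zero test). -/
theorem okF_1 : FchunkOKZ C16Q.cert.n C16Q.cert.d [FBlk.mk 0 C16Q.fw0, FBlk.mk 1 C16Q.fw1] [] C16Q.dFc1 = true := by
  decide +kernel

set_option maxRecDepth 100000 in
set_option maxHeartbeats 0 in
/-- `FI` expansion, blocks [2] (kernel, Gram form + sorted-merge zero test). -/
theorem okF_2 : FchunkOKZ C16Q.cert.n C16Q.cert.d [FBlk.mk 2 C16Q.fw2] C16Q.dFc1 C16Q.dFc2 = true := by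
  decide +kernel

end Summit.Ventures.PackingBounds.ThreePointCert.C16Q
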